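import Mathlib

/-!
# ValiantsHypothesis / LacunarySymmetroid — crux `MatrixDescartes` (stmt-ValiantsHypothesis-18050),
# line `Cruxes/MatrixDescartes/Lines/sign_split.lean`, stub `stub_perturb` (`PerturbToAlternation`,
# = `lorentzian_shadow`'s `stub_perturbT8`): PARTIAL LEMMAS — the ONE-VARIABLE heart of the even-multiplicity case

Helper file (`--supports stmt-ValiantsHypothesis-18050 --as helper`; cell val-lit, seat val-lit-p5 g9, merged desk
RULING #80).  Closes NO item and does NOT prove the stub; «V1 line stub; `MatrixDescartes` / Conjecture B /
`VP ≠ VNP` OPEN».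

Route to the even-multiplicity local splitting lemma (the residual of `…StubPerturbOddSplit`) by a RANK-ONE
perturbation `E = v vᵀ`: by the matrix determinant lemma `det (F(t) + η t^{d} v vᵀ) = p(t) + η q(t)` is AFFINE in
`η` (`q = t^{d} · vᵀ adj(F(t)) v`), so the local analysis at a root `t₀` of `p` of even multiplicity `μ` reduces to
one-variable asymptotics of `p + η q` when `q` vanishes at `t₀` to a LOWER order `ν < μ`.  This file proves that
one-variable statement in full:

* `eval_add_smul_of_factor` — `(p + η q)(t₀ + u) = u^ν (u^{μ-ν} P₁(t₀+u) + η Q₁(t₀+u))` from the factorisations;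
* **`localSplit_of_factor`** — if `p = (X - t₀)^μ P₁`, `q = (X - t₀)^ν Q₁` with `P₁(t₀), Q₁(t₀) ≠ 0`, `μ` even and
  `ν < μ`, then for one sign `s = ±1` and every `δ > 0` there is `ε₀ > 0` such that for all `0 < ε < ε₀` the
  polynomial `p + (sε) q` changes sign strictly inside `(t₀ - δ, t₀ + δ)` (case `ν` odd: either sign, two points
  `t₀ ± r`; case `ν` even: the sign making `sε Q₁(t₀)` oppose `P₁(t₀)`, points `t₀ + u₂ < t₀ + u₁`);
* **`localSplit_of_rootMultiplicity_lt`** — the same from `p, q ≠ 0`, `Even (rootMultiplicity t₀ p)` and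
  `rootMultiplicity t₀ q < rootMultiplicity t₀ p`.

What then remains for the stub (NOT proved here): for a symmetric pencil with `p = det F ≢ 0`, ONE vector `v` such
that at every positive root `t₀` of even multiplicity `ord_{t₀}(vᵀ adj(F) v) < ord_{t₀}(p)` (true for generic `v`:
`ord_{t₀} adj(F) ≤ ord_{t₀} p' = μ - 1` by Jacobi's formula `p' = tr(adj(F) F')`, and `vᵀ L v ≢ 0` for a nonzero
symmetric `L`), together with the determinant-lemma identity above.
-/

set_option linter.dupNamespace false

namespace Summit.ValiantsHypothesis.ValiantsHypothesis.Theorems.LacunarySymmetroidMatrixDescartes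

open Polynomial

namespace Perturb

/-! ## 1. The evaluation identity -/

/-- `(p + η q)(t₀ + u) = u^ν · (u^{k} P₁(t₀+u) + η Q₁(t₀+u))` when `p = (X - t₀)^{ν+k} P₁`, `q = (X - t₀)^ν Q₁`. -/
theorem eval_add_smul_of_factor (p q P₁ Q₁ : ℝ[X]) (t₀ : ℝ) (ν k : ℕ)
    (hp : p = (X - C t₀) ^ (ν + k) * P₁) (hq : q = (X - C t₀) ^ ν * Q₁) (η u : ℝ) :
    (p + η • q).eval (t₀ + u) = u ^ ν * (u ^ k * P₁.eval (t₀ + u) + η * Q₁.eval (t₀ + u)) := by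
  rw [hp, hq]
  simp only [eval_add, eval_smul, eval_mul, eval_pow, eval_sub, eval_X, eval_C, smul_eq_mul,
    add_sub_cancel_left, pow_add]
  ring

/-! ## 2. Continuity helpers -/

/-- A continuous real function nonzero at `0` keeps the sign of its value at `0` on a small interval to the right,
inside any prescribed `(0, r₀)`. -/
theorem exists_pos_lt_sameSign (g : ℝ → ℝ) (hg : Continuous g) (h0 : g 0 ≠ 0) (r₀ : ℝ) (hr₀ : 0 < r₀) :
    ∃ r : ℝ, 0 < r ∧ r < r₀ ∧ 0 < g 0 * g r ∧ 0 < g 0 * g (-r) := by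
  have hc : ContinuousAt (fun u => g 0 * g u) 0 := continuousAt_const.mul hg.continuousAt
  have hpos : 0 < g 0 * g 0 := mul_self_pos.mpr h0
  have hev : ∀ᶠ u in nhds (0 : ℝ), 0 < g 0 * g u := continuousAt_const.eventually_lt hc (by simpa using hpos)
  obtain ⟨ε, hε, h⟩ := Metric.eventually_nhds_iff.mp hev
  refine ⟨min (ε / 2) (r₀ / 2), lt_min (by linarith) (by linarith), (min_le_right _ _).trans_lt (by linarith),
    h ?_, h ?_⟩
  · rw [Real.dist_eq, sub_zero, abs_of_pos (lt_min (by linarith) (by linarith))]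
    exact (min_le_left _ _).trans_lt (by linarith)
  · rw [Real.dist_eq, sub_zero, abs_neg, abs_of_pos (lt_min (by linarith) (by linarith))]
    exact (min_le_left _ _).trans_lt (by linarith)

/-! ## 3. Local splitting from the factorisations -/

/-- **Local splitting, one-variable form.**  `p = (X - t₀)^μ P₁`, `q = (X - t₀)^ν Q₁`, `P₁(t₀) Q₁(t₀) ≠ 0`, `μ` even,
`ν < μ`: for one sign `s = ±1` and every `δ > 0` there is `ε₀ > 0` such that for all `0 < ε < ε₀` the polynomial
`p + (sε) q` takes values of opposite signs at two points `t₀ - δ < a < b < t₀ + δ`. -/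
theorem localSplit_of_factor (p q P₁ Q₁ : ℝ[X]) (t₀ : ℝ) (μ ν : ℕ)
    (hp : p = (X - C t₀) ^ μ * P₁) (hq : q = (X - C t₀) ^ ν * Q₁)
    (hP₁ : P₁.eval t₀ ≠ 0) (hQ₁ : Q₁.eval t₀ ≠ 0) (hμ : Even μ) (hνμ : ν < μ) :
    ∃ s : ℝ, (s = 1 ∨ s = -1) ∧ ∀ δ : ℝ, 0 < δ → ∃ ε₀ : ℝ, 0 < ε₀ ∧ ∀ ε : ℝ, 0 < ε → ε < ε₀ →
      ∃ a b : ℝ, t₀ - δ < a ∧ a < b ∧ b < t₀ + δ ∧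
        (p + (s * ε) • q).eval a * (p + (s * ε) • q).eval b < 0 := by
  obtain ⟨k, rfl⟩ : ∃ k, μ = ν + k := ⟨μ - ν, by omega⟩
  have hk : 0 < k := by omega
  set c := P₁.eval t₀ with hc
  set c' := Q₁.eval t₀ with hc'
  -- the bracket `g η u = u^k P₁(t₀+u) + η Q₁(t₀+u)`, continuous in `u` for fixed `η`
  set g : ℝ → ℝ → ℝ := fun η u => u ^ k * P₁.eval (t₀ + u) + η * Q₁.eval (t₀ + u) with hgdef
  have hgcont : ∀ η, Continuous (g η) := by
    intro η
    have h1 : Continuous fun u : ℝ => P₁.eval (t₀ + u) :=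
      (Polynomial.continuous P₁).comp (continuous_const.add continuous_id)
    have h2 : Continuous fun u : ℝ => Q₁.eval (t₀ + u) :=
      (Polynomial.continuous Q₁).comp (continuous_const.add continuous_id)
    exact ((continuous_pow k).mul h1).add (continuous_const.mul h2)
  have hg0 : ∀ η, g η 0 = η * c' := by intro η; simp [hgdef, hc', hk.ne']
  have hev : ∀ η u, (p + η • q).eval (t₀ + u) = u ^ ν * g η u := fun η u =>
    eval_add_smul_of_factor p q P₁ Q₁ t₀ ν k hp hq η u
  rcases Nat.even_or_odd ν with hν | hν
  · -- ν even: choose the sign so that sε c' opposes c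
    have hkeven : Even k := by
      rcases hμ with ⟨a, ha⟩; rcases hν with ⟨b, hb⟩; exact ⟨a - b, by omega⟩
    refine ⟨if c * c' < 0 then 1 else -1, by split_ifs <;> simp, fun δ hδ => ?_⟩
    set s : ℝ := if c * c' < 0 then 1 else -1 with hsdef
    have hs : s * (c * c') < 0 := by
      rw [hsdef]; split_ifs with h
      · linarith
      · have hne : c * c' ≠ 0 := mul_ne_zero hP₁ hQ₁
        have : 0 < c * c' := lt_of_le_of_ne (not_lt.mp h) (Ne.symm hne)
        linarith
    -- a fixed point u₁ ∈ (0, δ) where P₁ has the sign of c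
    obtain ⟨u₁, hu₁pos, hu₁δ, hu₁sign, -⟩ := exists_pos_lt_sameSign (fun u => P₁.eval (t₀ + u))
      ((Polynomial.continuous P₁).comp (continuous_const.add continuous_id)) (by simpa using hP₁) δ hδ
    simp only [add_zero] at hu₁sign
    -- for small η the bracket at u₁ still has the sign of c
    have hcη : ContinuousAt (fun η : ℝ => c * g η u₁) 0 :=
      continuousAt_const.mul ((continuous_const.add (continuous_id.mul continuous_const)).continuousAt)
    have hval0 : 0 < c * g 0 u₁ := by
      have : g 0 u₁ = u₁ ^ k * P₁.eval (t₀ + u₁) := by simp [hgdef]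
      rw [← hc] at hu₁sign
      rw [this, show c * (u₁ ^ k * P₁.eval (t₀ + u₁)) = u₁ ^ k * (c * P₁.eval (t₀ + u₁)) by ring]
      exact mul_pos (pow_pos hu₁pos k) hu₁sign
    obtain ⟨ε₀, hε₀, hε₀prop⟩ := Metric.eventually_nhds_iff.mp (continuousAt_const.eventually_lt hcη hval0)
    refine ⟨ε₀, hε₀, fun ε hεpos hεlt => ?_⟩
    have hη : 0 < c * g (s * ε) u₁ := by
      apply hε₀prop
      rw [Real.dist_eq, sub_zero, abs_mul, abs_of_pos hεpos]
      have : |s| = 1 := by rw [hsdef]; split_ifs <;> simp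
      rw [this, one_mul]; exact hεlt
    -- near 0 the bracket has the sign of sε c', i.e. opposite to c
    have hgs0 : g (s * ε) 0 ≠ 0 := by
      rw [hg0]; exact mul_ne_zero (mul_ne_zero (by rw [hsdef]; split_ifs <;> norm_num) hεpos.ne') hQ₁
    obtain ⟨u₂, hu₂pos, hu₂lt, hu₂sign, -⟩ := exists_pos_lt_sameSign (g (s * ε)) (hgcont _) hgs0 u₁ hu₁pos
    rw [hg0] at hu₂sign
    have hopp : c * g (s * ε) u₂ < 0 := by
      -- sign of g at u₂ = sign of sεc', which is opposite to the sign of c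
      have h1 : 0 < s * ε * c' * g (s * ε) u₂ := hu₂sign
      have h2 : s * ε * c' * c < 0 := by
        have : s * ε * c' * c = ε * (s * (c * c')) := by ring
        rw [this]; exact mul_neg_of_pos_of_neg hεpos hs
      have h3 : c * g (s * ε) u₂ * (s * ε * c' * (s * ε * c')) =
          s * ε * c' * c * (s * ε * c' * g (s * ε) u₂) := by ring
      have h4 : s * ε * c' * c * (s * ε * c' * g (s * ε) u₂) < 0 := mul_neg_of_neg_of_pos h2 h1
      have h5 : 0 < s * ε * c' * (s * ε * c') := by
        have hne : s * ε * c' ≠ 0 := by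
          intro h0; rw [h0, zero_mul] at h1; exact lt_irrefl 0 h1
        exact mul_self_pos.mpr hne
      by_contra hcon
      have h6 : 0 ≤ c * g (s * ε) u₂ * (s * ε * c' * (s * ε * c')) := mul_nonneg (not_lt.mp hcon) h5.le
      rw [h3] at h6
      exact absurd h4 (not_lt.mpr h6)
    refine ⟨t₀ + u₂, t₀ + u₁, by linarith, by linarith, by linarith, ?_⟩
    rw [show t₀ + u₂ = t₀ + u₂ from rfl, hev, hev]
    have hu₂ν : 0 < u₂ ^ ν := pow_pos hu₂pos ν
    have hu₁ν : 0 < u₁ ^ ν := pow_pos hu₁pos ν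
    -- (u₂^ν g u₂)(u₁^ν g u₁) < 0 since c g(u₂) < 0 < c g(u₁)
    have : g (s * ε) u₂ * g (s * ε) u₁ < 0 := by
      have := mul_neg_of_neg_of_pos hopp hη
      have hcc : 0 < c * c := mul_self_pos.mpr hP₁
      nlinarith
    nlinarith [mul_pos hu₂ν hu₁ν]
  · -- ν odd: either sign works; the two points t₀ ± r
    refine ⟨1, Or.inl rfl, fun δ hδ => ⟨1, one_pos, fun ε hεpos _ => ?_⟩⟩
    have hgs0 : g (1 * ε) 0 ≠ 0 := by rw [hg0]; exact mul_ne_zero (by positivity) hQ₁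
    obtain ⟨r, hrpos, hrδ, hr1, hr2⟩ := exists_pos_lt_sameSign (g (1 * ε)) (hgcont _) hgs0 δ hδ
    refine ⟨t₀ + -r, t₀ + r, by linarith, by linarith, by linarith, ?_⟩
    rw [hev, hev]
    have hodd : (-r) ^ ν = -(r ^ ν) := Odd.neg_pow hν r
    rw [hodd]
    have hrν : 0 < r ^ ν := pow_pos hrpos ν
    -- g(-r) and g(r) have the sign of g 0; the prefactors have opposite signs
    have hsame : 0 < g (1 * ε) (-r) * g (1 * ε) r := by
      have h00 : 0 < g (1 * ε) 0 * g (1 * ε) 0 := mul_self_pos.mpr hgs0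
      nlinarith [hr1, hr2, h00]
    nlinarith [mul_pos hrν hrν, hsame]

/-- **Local splitting from root multiplicities.**  For real polynomials `p, q ≠ 0` and a point `t₀` with
`rootMultiplicity t₀ p` even and `rootMultiplicity t₀ q < rootMultiplicity t₀ p`, the pencil `p + (sε) q` splits
locally at `t₀` for one sign `s = ±1`. -/
theorem localSplit_of_rootMultiplicity_lt (p q : ℝ[X]) (hp : p ≠ 0) (hq : q ≠ 0) (t₀ : ℝ)
    (heven : Even (p.rootMultiplicity t₀)) (hlt : q.rootMultiplicity t₀ < p.rootMultiplicity t₀) :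
    ∃ s : ℝ, (s = 1 ∨ s = -1) ∧ ∀ δ : ℝ, 0 < δ → ∃ ε₀ : ℝ, 0 < ε₀ ∧ ∀ ε : ℝ, 0 < ε → ε < ε₀ →
      ∃ a b : ℝ, t₀ - δ < a ∧ a < b ∧ b < t₀ + δ ∧
        (p + (s * ε) • q).eval a * (p + (s * ε) • q).eval b < 0 := by
  obtain ⟨P₁, hpP, hP₁⟩ := Polynomial.exists_eq_pow_rootMultiplicity_mul_and_not_dvd p hp t₀
  obtain ⟨Q₁, hqQ, hQ₁⟩ := Polynomial.exists_eq_pow_rootMultiplicity_mul_and_not_dvd q hq t₀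
  refine localSplit_of_factor p q P₁ Q₁ t₀ _ _ hpP hqQ ?_ ?_ heven hlt
  · exact fun h => hP₁ (Polynomial.dvd_iff_isRoot.mpr h)
  · exact fun h => hQ₁ (Polynomial.dvd_iff_isRoot.mpr h)

end Perturb

end Summit.ValiantsHypothesis.ValiantsHypothesis.Theorems.LacunarySymmetroidMatrixDescartes
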